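import Summits.QuantumFields.BalabanUV.T4Continuum.Support.NE7EffectiveFormLevelLimitFlat
import Summits.QuantumFields.BalabanUV.T4Continuum.Support.NE7EffectiveFormKernelFlatCharacterisation
import Summits.QuantumFields.BalabanUV.T4Continuum.Support.NE7EffectiveFormLandauSliceGap
import HarnessLib

/-!
# NE7EffectiveFormLevelLimitKernel — THE INFINITE-LEVEL LIMIT `Δ_∞` OF THE FLAT EFFECTIVE FORMS HAS THE KERNEL OF EVERY `Δ_{j+1}` (`= {dλ + c}`) AND THE LANDAU GAP `2∕(N(N−1))`

Lineage `b2b-balaban-t4-ne7-p1` (CRUX PROVER NE7 #1 = OWNER of BINDER row NE7), generation 116; sequel of ✓ `NE7EffectiveFormLevelLimitFlat` (`D²m_{j+1}(0)[v,v] ↑ q(v)`, two-sided Maxwell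
bounds).  Since `0 ≤ Σ_P‖curl_1 ṽ‖² ≤ D²m_{j+1}(0)[v,v] ≤ q(v)` for every `j` and `q(v) = 0 ⟺ ṽ` closed: **`levelLimit_eq_zero_iff_all_levels`** (`q(v) = 0 ⟺ ∀ j, D²m_{j+1}(0)[v,v] = 0 ⟺
D²m_1(0)[v,v] = 0`), hence by ✓ `NE7EffectiveFormKernelFlatCharacterisation.effectiveForm_kernel_flat_allLevels_iff` **`levelLimit_eq_zero_iff_exact_add_const`** (`q(v) = 0 ⟺ v = res(dλ + c)`,
`λ` skew `N`-periodic, `c` skew constant) and by ✓ `NE7EffectiveFormLandauSliceGap.effectiveForm_landau_meanZero_gap_flat_allLevels` (row NE7b) **`levelLimit_landau_meanZero_gap`** (on the coarse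
Landau slice with zero means, `Σ_x Σ_ν nhsNormSq(ṽ x ν) ≤ (N(N−1)∕2)·q(v)`).  Here `q(v)` is ANY limit of the sequence (hypothesis `Tendsto`), so the statements apply verbatim to the diagonal of the
bilinear `Δ_∞` of ✓ `NE7EffectiveFormLevelLimitOperator`.  [folklore]; 0 def, 0 sorry.
HONEST FRAMING: flat datum; OUR minimisers (B11 (8) with `sfClass`); `j → ∞` at FIXED coarse lattice, NOT a continuum limit; nothing of Bałaban's asserted; NOT NE7 as a spine node; spine 0∕9;
NOT infinite volume, NOT mass gap, NOT BetaPertH, NOT Clay.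
-/

set_option autoImplicit false

open scoped BigOperators Matrix Matrix.Norms.L2Operator Topology
open NormedSpace Finset Filter

namespace Summit.QuantumFields.BalabanUV.T4Continuum.NE7EffectiveFormLevelLimitKernel

open Literature.MathematicalPhysics.QuantumFieldTheory.Balaban1983to89
open B7Prop1Explicit B7Prop2Explicit
open T4AveragingDeficitWall (curl)
open BlockAveragePushDirGauge (gaugeDir)
open T4AveragingDeficitWallBoundary (periodBox)
open AveragingDeficitTorusChart (TDir chart chartDir resDir)
open AveragingDeficitTwoLevelPrep (skewSub)
open MinimalActionLevels (perWin)
open MinimalActionSandwich (minAct)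
open MinimalActionRate (sfClass)
open MinimalActionWitness (flatCfg)
open MatrixNorms (nhsNormSq nhsNormSq_nonneg)
open NE7EffectiveFormLevelLimitFlat (effectiveForm_tendsto_level_flat effectiveForm_levelLimit_eq_zero_iff)
open NE7EffectiveFormCoarseCurlAllLevels (effectiveForm_ge_coarse_curl_flat_allLevels' effectiveForm_kernel_closed_flat_allLevels)
open NE7EffectiveFormKernelFlatCharacterisation (effectiveForm_kernel_flat_allLevels_iff)
open NE7EffectiveFormLandauSliceGap (effectiveForm_landau_meanZero_gap_flat_allLevels)

noncomputable section

variable {n : Type} [Fintype n] [DecidableEq n]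

/-- **THE LIMIT VANISHES IFF EVERY (EQUIVALENTLY THE FIRST) LEVEL FORM VANISHES** (`d = 4`, every `U(n)`, `L ≥ 2`): for any limit `q` of `j ↦ D²m_{j+1}(0)[v,v]`,
`q = 0 ⟺ (∀ j, D²m_{j+1}(0)[v,v] = 0)` and `q = 0 ⟺ D²m_1(0)[v,v] = 0`. [folklore] -/
theorem levelLimit_eq_zero_iff_all_levels [Nonempty n] {L : ℕ} [NeZero L] (hL : 2 ≤ L) :
    ∃ ε₀ : ℝ, 0 < ε₀ ∧ ∀ ε : ℝ, 0 < ε → ε ≤ ε₀ → ∀ (N : ℕ) [NeZero N], 1 ≤ N → ∀ (v : ↥(skewSub 4 n N)) (q : ℝ),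
      Tendsto (fun j : ℕ => fderiv ℝ (fderiv ℝ (fun y : ↥(skewSub 4 n N) => minAct 4 (sfClass 4 L N ε) L N (j + 1)
          (chart (ContinuousLinearMap.id ℝ (Matrix n n ℂ)) N (flatCfg : Site 4 → Fin 4 → (Matrix n n ℂ)ˣ) (y : TDir 4 n N)))) 0 v v) atTop (𝓝 q) →
      (q = 0 ↔ ∀ j : ℕ, fderiv ℝ (fderiv ℝ (fun y : ↥(skewSub 4 n N) => minAct 4 (sfClass 4 L N ε) L N (j + 1)
          (chart (ContinuousLinearMap.id ℝ (Matrix n n ℂ)) N (flatCfg : Site 4 → Fin 4 → (Matrix n n ℂ)ˣ) (y : TDir 4 n N)))) 0 v v = 0) ∧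
      (q = 0 ↔ fderiv ℝ (fderiv ℝ (fun y : ↥(skewSub 4 n N) => minAct 4 (sfClass 4 L N ε) L N (0 + 1)
          (chart (ContinuousLinearMap.id ℝ (Matrix n n ℂ)) N (flatCfg : Site 4 → Fin 4 → (Matrix n n ℂ)ˣ) (y : TDir 4 n N)))) 0 v v = 0) := by
  obtain ⟨ε₁, hε₁, H₁⟩ := effectiveForm_tendsto_level_flat (n := n) hL
  obtain ⟨ε₂, hε₂, H₂⟩ := effectiveForm_ge_coarse_curl_flat_allLevels' (n := n) hL
  obtain ⟨ε₃, hε₃, H₃⟩ := effectiveForm_levelLimit_eq_zero_iff (n := n) hL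
  obtain ⟨ε₄, hε₄, H₄⟩ := effectiveForm_kernel_closed_flat_allLevels (n := n) hL
  refine ⟨min (min ε₁ ε₂) (min ε₃ ε₄), lt_min (lt_min hε₁ hε₂) (lt_min hε₃ hε₄), fun ε hε hεle N _ hN v q hq => ?_⟩
  have hε1 : ε ≤ ε₁ := hεle.trans ((min_le_left _ _).trans (min_le_left _ _))
  have hε2 : ε ≤ ε₂ := hεle.trans ((min_le_left _ _).trans (min_le_right _ _))
  have hε3 : ε ≤ ε₃ := hεle.trans ((min_le_right _ _).trans (min_le_left _ _))
  have hε4 : ε ≤ ε₄ := hεle.trans ((min_le_right _ _).trans (min_le_right _ _))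
  obtain ⟨q', hq', hle, -, -⟩ := H₁ ε hε hε1 N hN v
  have hqq : q = q' := tendsto_nhds_unique hq hq'
  subst hqq
  have hc0 : 0 ≤ ∑ P ∈ perWin 4 N, nhsNormSq (curl (flatCfg : Site 4 → Fin 4 → (Matrix n n ℂ)ˣ)
      (chartDir (ContinuousLinearMap.id ℝ (Matrix n n ℂ)) N (v : TDir 4 n N)) P) := Finset.sum_nonneg fun P _ => nhsNormSq_nonneg _
  have hlow : ∀ j, 0 ≤ fderiv ℝ (fderiv ℝ (fun y : ↥(skewSub 4 n N) => minAct 4 (sfClass 4 L N ε) L N (j + 1)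
      (chart (ContinuousLinearMap.id ℝ (Matrix n n ℂ)) N (flatCfg : Site 4 → Fin 4 → (Matrix n n ℂ)ˣ) (y : TDir 4 n N)))) 0 v v :=
    fun j => hc0.trans (H₂ ε hε hε2 N hN j v)
  have hall : q = 0 → ∀ j, fderiv ℝ (fderiv ℝ (fun y : ↥(skewSub 4 n N) => minAct 4 (sfClass 4 L N ε) L N (j + 1)
      (chart (ContinuousLinearMap.id ℝ (Matrix n n ℂ)) N (flatCfg : Site 4 → Fin 4 → (Matrix n n ℂ)ˣ) (y : TDir 4 n N)))) 0 v v = 0 := by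
    intro hq0 j
    have h := hle j
    rw [hq0] at h
    exact le_antisymm h (hlow j)
  have hone : fderiv ℝ (fderiv ℝ (fun y : ↥(skewSub 4 n N) => minAct 4 (sfClass 4 L N ε) L N (0 + 1)
      (chart (ContinuousLinearMap.id ℝ (Matrix n n ℂ)) N (flatCfg : Site 4 → Fin 4 → (Matrix n n ℂ)ˣ) (y : TDir 4 n N)))) 0 v v = 0 → q = 0 := by
    intro h0
    exact (H₃ ε hε hε3 N hN v q hq).mpr (H₄ ε hε hε4 N hN 0 v h0)
  exact ⟨⟨hall, fun h => hone (h 0)⟩, ⟨fun h => hall h 0, hone⟩⟩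

/-- **THE KERNEL OF `Δ_∞` IS THE LINEARISED GAUGE DIRECTIONS PLUS THE CONSTANTS**: for any limit `q` of `j ↦ D²m_{j+1}(0)[v,v]`, `q = 0 ⟺ v = res(dλ + c)` (`λ` skew `N`-periodic,
`c` skew). [folklore] -/
theorem levelLimit_eq_zero_iff_exact_add_const [Nonempty n] {L : ℕ} [NeZero L] (hL : 2 ≤ L) :
    ∃ ε₀ : ℝ, 0 < ε₀ ∧ ∀ ε : ℝ, 0 < ε → ε ≤ ε₀ → ∀ (N : ℕ) [NeZero N], 1 ≤ N → ∀ (v : ↥(skewSub 4 n N)) (q : ℝ),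
      Tendsto (fun j : ℕ => fderiv ℝ (fderiv ℝ (fun y : ↥(skewSub 4 n N) => minAct 4 (sfClass 4 L N ε) L N (j + 1)
          (chart (ContinuousLinearMap.id ℝ (Matrix n n ℂ)) N (flatCfg : Site 4 → Fin 4 → (Matrix n n ℂ)ˣ) (y : TDir 4 n N)))) 0 v v) atTop (𝓝 q) →
      (q = 0 ↔ ∃ (lam : Site 4 → Matrix n n ℂ) (c : Fin 4 → Matrix n n ℂ),
        (∀ (x : Site 4) (i : Fin 4), lam (x + (N : ℤ) • e i) = lam x) ∧ (∀ x : Site 4, lam x ∈ skewAdjoint (Matrix n n ℂ)) ∧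
        (∀ μ : Fin 4, c μ ∈ skewAdjoint (Matrix n n ℂ)) ∧
        (v : TDir 4 n N) = resDir N (fun x μ => gaugeDir (flatCfg : Site 4 → Fin 4 → (Matrix n n ℂ)ˣ) lam x μ + c μ)) := by
  obtain ⟨ε₁, hε₁, H₁⟩ := levelLimit_eq_zero_iff_all_levels (n := n) hL
  obtain ⟨ε₂, hε₂, H₂⟩ := effectiveForm_kernel_flat_allLevels_iff (n := n) hL
  refine ⟨min ε₁ ε₂, lt_min hε₁ hε₂, fun ε hε hεle N _ hN v q hq => ?_⟩
  rw [(H₁ ε hε (hεle.trans (min_le_left _ _)) N hN v q hq).2]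
  exact H₂ ε hε (hεle.trans (min_le_right _ _)) N hN 0 v

/-- **THE LANDAU MEAN-ZERO GAP OF `Δ_∞`**: on the coarse Landau slice with zero means, `Σ_x Σ_ν nhsNormSq(ṽ x ν) ≤ (N(N−1)∕2)·q(v)` for any limit `q` (row NE7b's gap at every level,
passed to the limit — indeed already `≤` the first level). [folklore] -/
theorem levelLimit_landau_meanZero_gap [Nonempty n] {L : ℕ} [NeZero L] (hL : 2 ≤ L) :
    ∃ ε₀ : ℝ, 0 < ε₀ ∧ ∀ ε : ℝ, 0 < ε → ε ≤ ε₀ → ∀ (N : ℕ) [NeZero N], 1 ≤ N → ∀ (v : ↥(skewSub 4 n N)) (q : ℝ),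
      Tendsto (fun j : ℕ => fderiv ℝ (fderiv ℝ (fun y : ↥(skewSub 4 n N) => minAct 4 (sfClass 4 L N ε) L N (j + 1)
          (chart (ContinuousLinearMap.id ℝ (Matrix n n ℂ)) N (flatCfg : Site 4 → Fin 4 → (Matrix n n ℂ)ˣ) (y : TDir 4 n N)))) 0 v v) atTop (𝓝 q) →
      (∀ x : Site 4, ∑ μ : Fin 4,
          (chartDir (ContinuousLinearMap.id ℝ (Matrix n n ℂ)) N (v : TDir 4 n N) x μ
            - chartDir (ContinuousLinearMap.id ℝ (Matrix n n ℂ)) N (v : TDir 4 n N) (x - e μ) μ) = 0) →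
      (∀ ν : Fin 4, ∑ z ∈ periodBox N, chartDir (ContinuousLinearMap.id ℝ (Matrix n n ℂ)) N (v : TDir 4 n N) z ν = 0) →
      ∑ x ∈ periodBox N, ∑ ν : Fin 4, nhsNormSq (chartDir (ContinuousLinearMap.id ℝ (Matrix n n ℂ)) N (v : TDir 4 n N) x ν)
        ≤ (N : ℝ) * ((N : ℝ) - 1) / 2 * q := by
  obtain ⟨ε₁, hε₁, H₁⟩ := effectiveForm_tendsto_level_flat (n := n) hL
  obtain ⟨ε₂, hε₂, H₂⟩ := effectiveForm_landau_meanZero_gap_flat_allLevels (n := n) hL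
  refine ⟨min ε₁ ε₂, lt_min hε₁ hε₂, fun ε hε hεle N _ hN v q hq hdiv hmean => ?_⟩
  obtain ⟨q', hq', hle, -, -⟩ := H₁ ε hε (hεle.trans (min_le_left _ _)) N hN v
  have hqq : q = q' := tendsto_nhds_unique hq hq'
  subst hqq
  have hN1 : (1 : ℝ) ≤ N := by exact_mod_cast hN
  have hcoef : 0 ≤ (N : ℝ) * ((N : ℝ) - 1) / 2 := by nlinarith
  exact (H₂ ε hε (hεle.trans (min_le_right _ _)) N hN 0 v hdiv hmean).trans (mul_le_mul_of_nonneg_left (hle 0) hcoef)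

end

end Summit.QuantumFields.BalabanUV.T4Continuum.NE7EffectiveFormLevelLimitKernel
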